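import Literature.NumberTheory.EllipticCurves.DescendedFrobeniusMatrix
import Summits.BirchSwinnertonDyer.BirchSwinnertonDyer.Theorems.CyclotomicUntwistSecondKindFrobenius
import Mathlib.Algebra.CharP.Quotient
import Mathlib.RingTheory.IntegralClosure.IntegrallyClosed
import HarnessLib

/-!
# Route `CyclotomicUntwist`: SEMANTICS of the Berthelot–Ogus transfer on the RAMIFIED side — Katz's Key Lemma over
# `𝓞 = 𝓞_{ℚ₃(ζ₉)}` and the ninth-power congruence `Ĝ(X,Y)⁹ ≡ G₀(X⁹,Y⁹) (mod 3)` for a good model congruent to a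
# `ℤ₃`-lift modulo `ϖ` (`ϖ⁶ ∈ 3𝓞`): the transfer `f ↦ f(z⁹)` lands in Katz's module of the GOOD MODEL's formal group

Cell `pub/bsd-wall` (D-0145 line `route-BirchSwinnertonDyer-CyclotomicUntwist`), prover seat `bsd-line-cycu-p2`
(gen 6), lane «D5» (memo `D5-TYPING-v1.md` §2; the part marked "typer / later seat, M" in §4). THEOREMS ONLY (no
definition, no named fact, no `sorry`); helper `--supports` K1 = stmt-BirchSwinnertonDyer-21580. BSD is not proved by
this file and no crux is. Currency: `KNine`, `ONine` of `Literature.DescendedFrobeniusMatrix` (p623342).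

WHY. Both D5 formulations (the Literature power maps `z⁹ = φ²`, `z²⁷ = φ³`; this seat's transfer basis
`ℓ₀ = log₀(z⁹)`, `ℓ₁ = log₀(z²⁷)`) rest on Katz 1981 Thm 5.1.4 over the ramified ring `𝓞 = 𝓞_{ℚ₃(ζ₉)}` with the
divided-power ideal `(3)`: a pointed power-series map whose reduction mod `3` is a HOMOMORPHISM of the reductions acts
on the modules of functions of the second kind. For `z ↦ z⁹` between the good model's formal group `Ĝ` and the
constant group of a `ℤ₃`-lift `G₀` of the special fibre this needs `Ĝ(X,Y)⁹ ≡ G₀(X⁹,Y⁹) (mod 3𝓞⟦X,Y⟧)` — the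
Berthelot–Ogus observation that `x ↦ x⁹` on `𝓞/3` factors through `𝔽₃`. This file proves it and the Key Lemma:

* §1 `pow_nine_sub_dvd`: `x ≡ y (mod ϖ)`, `y ∈ ℤ₃`, `3 ∣ ϖ⁶` ⟹ `3 ∣ x⁹ − y` in `𝓞` (binomials `C(9,i)`, `0 < i < 9`, are
  divisible by `3`; `y⁹ ≡ y`); `three_not_isUnit_ONine` (`ℤ₃` integrally closed);
* §2 `three_dvd_coeff_pow_nine_sub_expand`: coefficientwise `3 ∣ a_d⁹ − b_d` ⟹ `3 ∣ [X^d](F⁹ − F₀(X⁹,Y⁹))` in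
  `𝓞⟦X,Y⟧` (Frobenius of `(𝓞/3)⟦X,Y⟧`, Mathlib `MvPowerSeries.map_iterateFrobenius_expand`, `CharP (𝓞/3) 3`);
* §3 `isIntegral_mvCoeff_subst_sub_subst` — Katz's Key Lemma 5.1.3 over `𝓞`: `n·[zⁿ]f ∈ ℤ₃`, `U ≡ V (mod 3𝓞⟦X,Y⟧)`
  without constant terms ⟹ `f(U) − f(V)` has `𝓞`-integral coefficients (`mp ∣ Uᵐ − Vᵐ`);
* §4 `formalGroupLaw_congr_mod`: `E ≡ E₀ (mod ϖ)` on the `aᵢ` ⟹ `Ĝ ≡ G₀ (mod ϖ)` coefficientwise; and the assembly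
  **`transfer_coboundary_integral`**: for such `E` (good model over `𝓞`), `E₀ = V₀ ⊗ 𝓞` (`V₀/ℤ₃`), `3 ∣ ϖ⁶`, and
  `f ∈ ℚ₃⟦z⟧` with `n·[zⁿ]f ∈ ℤ₃` whose `G₀`-coboundary has `3ᴮ`-bounded coefficients:
  `∂_Ĝ(f(z⁹)) = f(Ĝ⁹) − f(X⁹) − f(Y⁹)` has `𝓞`-INTEGRAL coefficients after multiplication by `3ᴮ` — i.e.
  `[f(z⁹)] ∈ D(Ê/𝓞)_ℚ`: the transfer classes `ℓ₀, ℓ₁` of the D5 pin are honest classes of the good model's module.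
[cite: Katz1981CrystallineDieudonne, §5 Key Lemma 5.1.3 and Thm 5.1.4] [cite: BerthelotOgus1983, Thm. 2.4 (proof)]
-/

set_option autoImplicit false
-- single-conjunct summit: `Summit.BirchSwinnertonDyer.BirchSwinnertonDyer.…` repeats the name by design
set_option linter.dupNamespace false

noncomputable section

open PowerSeries Literature.RingTheory.FormalGroups Literature.NumberTheory.EllipticCurves
  Literature.NumberTheory.EllipticCurves.DescendedFrobenius

namespace Summit.BirchSwinnertonDyer.BirchSwinnertonDyer.Theorems.DescendedFrobeniusTransfer

/-! ## §1 Scalars: `x ≡ y (mod ϖ)` ⟹ `x⁹ ≡ y (mod 3)` -/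

/-- `(y + w)⁹ = y⁹ + w⁹ + 3·q` in any commutative ring (the binomials `C(9,i)`, `0 < i < 9`, are multiples of `3`).
[folklore] -/
theorem add_pow_nine (R : Type*) [CommRing R] (y w : R) :
    (y + w) ^ 9 = y ^ 9 + w ^ 9 + 3 * (3 * y ^ 8 * w + 12 * y ^ 7 * w ^ 2 + 28 * y ^ 6 * w ^ 3 + 42 * y ^ 5 * w ^ 4 +
      42 * y ^ 4 * w ^ 5 + 28 * y ^ 3 * w ^ 6 + 12 * y ^ 2 * w ^ 7 + 3 * y * w ^ 8) := by
  ring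

/-- `y⁹ ≡ y (mod 3)` in `ℤ₃` (Fermat twice: `y³ ≡ y`). [folklore] -/
theorem three_dvd_pow_nine_sub (y : ℤ_[3]) : (3 : ℤ_[3]) ∣ y ^ 9 - y := by
  have h3 : (3 : ℤ_[3]) ∣ y ^ 3 - y := by
    have hker : y ^ 3 - y ∈ RingHom.ker (PadicInt.toZMod (p := 3)) := by
      rw [RingHom.mem_ker, map_sub, map_pow, ZMod.pow_card, sub_self]
    rw [PadicInt.ker_toZMod, PadicInt.maximalIdeal_eq_span_p, Ideal.mem_span_singleton] at hker
    exact_mod_cast hker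
  have e : y ^ 9 - y = (y ^ 3 - y) * (y ^ 6 + y ^ 4 + y ^ 2) + (y ^ 3 - y) := by ring
  rw [e]; exact (h3.mul_right _).add h3

/-- **`x⁹ ≡ y (mod 3𝓞)`** for `x ∈ 𝓞 = 𝓞_{ℚ₃(ζ₉)}`, `y ∈ ℤ₃`, `x ≡ y (mod ϖ)` with `3 ∣ ϖ⁶` — the ninth-power map of
`𝓞/3` factors through the residue field (Berthelot–Ogus's observation behind the transfer, `9 ≥ e = 6`).
[cite: BerthelotOgus1983, Thm. 2.4 (proof)] -/
theorem pow_nine_sub_dvd {ϖ : ONine} (hϖ : (3 : ONine) ∣ ϖ ^ 6) {x : ONine} {y : ℤ_[3]}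
    (h : ϖ ∣ x - algebraMap ℤ_[3] ONine y) : (3 : ONine) ∣ x ^ 9 - algebraMap ℤ_[3] ONine y := by
  obtain ⟨k, hk⟩ := h
  have hx : x = algebraMap ℤ_[3] ONine y + ϖ * k := by rw [← hk]; ring
  have h9 : (3 : ONine) ∣ (ϖ * k) ^ 9 := by
    rw [mul_pow, show ϖ ^ 9 = ϖ ^ 6 * ϖ ^ 3 by ring, mul_assoc]
    exact hϖ.mul_right _
  have hy : (3 : ONine) ∣ (algebraMap ℤ_[3] ONine y) ^ 9 - algebraMap ℤ_[3] ONine y := by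
    have := map_dvd (algebraMap ℤ_[3] ONine) (three_dvd_pow_nine_sub y)
    rwa [map_ofNat, map_sub, map_pow] at this
  rw [hx, add_pow_nine]
  have e : (algebraMap ℤ_[3] ONine y) ^ 9 + (ϖ * k) ^ 9 + 3 * (3 * (algebraMap ℤ_[3] ONine y) ^ 8 * (ϖ * k) +
      12 * (algebraMap ℤ_[3] ONine y) ^ 7 * (ϖ * k) ^ 2 + 28 * (algebraMap ℤ_[3] ONine y) ^ 6 * (ϖ * k) ^ 3 +
      42 * (algebraMap ℤ_[3] ONine y) ^ 5 * (ϖ * k) ^ 4 + 42 * (algebraMap ℤ_[3] ONine y) ^ 4 * (ϖ * k) ^ 5 +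
      28 * (algebraMap ℤ_[3] ONine y) ^ 3 * (ϖ * k) ^ 6 + 12 * (algebraMap ℤ_[3] ONine y) ^ 2 * (ϖ * k) ^ 7 +
      3 * (algebraMap ℤ_[3] ONine y) * (ϖ * k) ^ 8) - algebraMap ℤ_[3] ONine y =
      ((algebraMap ℤ_[3] ONine y) ^ 9 - algebraMap ℤ_[3] ONine y) + (ϖ * k) ^ 9 +
      3 * (3 * (algebraMap ℤ_[3] ONine y) ^ 8 * (ϖ * k) +
      12 * (algebraMap ℤ_[3] ONine y) ^ 7 * (ϖ * k) ^ 2 + 28 * (algebraMap ℤ_[3] ONine y) ^ 6 * (ϖ * k) ^ 3 +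
      42 * (algebraMap ℤ_[3] ONine y) ^ 5 * (ϖ * k) ^ 4 + 42 * (algebraMap ℤ_[3] ONine y) ^ 4 * (ϖ * k) ^ 5 +
      28 * (algebraMap ℤ_[3] ONine y) ^ 3 * (ϖ * k) ^ 6 + 12 * (algebraMap ℤ_[3] ONine y) ^ 2 * (ϖ * k) ^ 7 +
      3 * (algebraMap ℤ_[3] ONine y) * (ϖ * k) ^ 8) := by ring
  rw [e]
  exact (hy.add h9).add (dvd_mul_right 3 _)

/-- `3` is not a unit of `𝓞`: otherwise `1/3 ∈ ℚ₃` would be integral over `ℤ₃` (`ℤ₃` is integrally closed).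
[folklore] -/
theorem three_not_isUnit_ONine : ¬ IsUnit (3 : ONine) := by
  intro h
  obtain ⟨u, hu⟩ := h
  -- the inverse, read in `KNine`, is `algebraMap ℚ₃ KNine (1/3)` and is integral
  have hinv : IsIntegral ℤ_[3] (algebraMap ONine KNine ((u⁻¹ : ONineˣ) : ONine)) :=
    ((u⁻¹ : ONineˣ) : ONine).2
  have h1 : algebraMap ONine KNine (u : ONine) * algebraMap ONine KNine ((u⁻¹ : ONineˣ) : ONine) = 1 := by
    rw [← map_mul, Units.mul_inv, map_one]
  rw [hu, map_ofNat] at h1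
  have hval : algebraMap ONine KNine ((u⁻¹ : ONineˣ) : ONine) = algebraMap ℚ_[3] KNine (3 : ℚ_[3])⁻¹ := by
    rw [map_inv₀, map_ofNat]
    exact eq_inv_of_mul_eq_one_right h1
  rw [hval, isIntegral_algebraMap_iff (algebraMap ℚ_[3] KNine).injective] at hinv
  obtain ⟨z, hz⟩ := IsIntegrallyClosed.algebraMap_eq_of_integral hinv
  have hn : ‖((3 : ℚ_[3])⁻¹)‖ ≤ 1 := by rw [← hz]; exact PadicInt.norm_le_one z
  rw [norm_inv, show ‖(3 : ℚ_[3])‖ = (3 : ℝ)⁻¹ by exact_mod_cast Padic.norm_p (p := 3), inv_inv] at hn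
  norm_num at hn

/-! ## §2 Series: `Ĝ(X,Y)⁹ ≡ G₀(X⁹,Y⁹) (mod 3𝓞⟦X,Y⟧)` -/

/-- **The ninth-power congruence for two-variable series.** If `3 ∣ a_d⁹ − b_d` for all coefficients (`a_d` of `F`,
`b_d` of `F₀`), then `3 ∣ [X^d](F⁹ − F₀(X⁹, Y⁹))` for every `d`: in `(𝓞/3)⟦X,Y⟧` (characteristic `3`) the
`9`-th power is the second Frobenius iterate, which acts coefficientwise on `expand 9`.
[cite: BerthelotOgus1983, Thm. 2.4 (proof)] -/
theorem three_dvd_coeff_pow_nine_sub_expand {σ : Type*} {F F₀ : MvPowerSeries σ ONine}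
    (hcong : ∀ d, (3 : ONine) ∣ MvPowerSeries.coeff d F ^ 9 - MvPowerSeries.coeff d F₀) (d : σ →₀ ℕ) :
    (3 : ONine) ∣ MvPowerSeries.coeff d (F ^ 9 - MvPowerSeries.expand 9 (by norm_num) F₀) := by
  set I : Ideal ONine := Ideal.span {(3 : ONine)} with hI
  haveI hchar : CharP (ONine ⧸ Ideal.span ({((3 : ℕ) : ONine)} : Set ONine)) 3 :=
    CharP.quotient ONine 3 (by exact_mod_cast three_not_isUnit_ONine)
  set π : ONine →+* ONine ⧸ Ideal.span ({((3 : ℕ) : ONine)} : Set ONine) := Ideal.Quotient.mk _ with hπ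
  have hfrob := MvPowerSeries.map_iterateFrobenius_expand 3 (prime_ne_zero 3) (F.map π) 2
  -- `(F.map π)⁹ = expand 9 (F₀.map π)`
  have hcoef : MvPowerSeries.map (iterateFrobenius _ 3 2) (MvPowerSeries.expand (3 ^ 2) (pow_ne_zero 2 (prime_ne_zero 3))
      (F.map π)) = MvPowerSeries.expand 9 (by norm_num) (F₀.map π) := by
    rw [MvPowerSeries.map_expand]
    have e9 : MvPowerSeries.expand (3 ^ 2) (pow_ne_zero 2 (prime_ne_zero 3))
        (MvPowerSeries.map (iterateFrobenius _ 3 2) (F.map π)) =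
        MvPowerSeries.expand 9 (by norm_num) (MvPowerSeries.map (iterateFrobenius _ 3 2) (F.map π)) := by
      ext e; simp only [show (3 : ℕ) ^ 2 = 9 by norm_num]
    rw [e9]
    congr 1
    ext e
    rw [MvPowerSeries.coeff_map, MvPowerSeries.coeff_map, MvPowerSeries.coeff_map, iterateFrobenius_def,
      show (3 : ℕ) ^ 2 = 9 by norm_num, ← map_pow, Ideal.Quotient.eq, Nat.cast_ofNat]
    exact Ideal.mem_span_singleton.mpr (hcong e)
  rw [hcoef, show (3 : ℕ) ^ 2 = 9 by norm_num] at hfrob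
  have h0 : π (MvPowerSeries.coeff d (F ^ 9 - MvPowerSeries.expand 9 (by norm_num) F₀)) = 0 := by
    rw [← MvPowerSeries.coeff_map, map_sub, map_pow, MvPowerSeries.map_expand, ← hfrob, sub_self,
      MvPowerSeries.coeff_zero]
  rw [hπ, Ideal.Quotient.eq_zero_iff_mem, Nat.cast_ofNat, Ideal.mem_span_singleton] at h0
  exact h0


/-! ## §3 Katz's Key Lemma 5.1.3 over `𝓞 = 𝓞_{ℚ₃(ζ₉)}` -/

/-- Truncation formula for substitution into a several-variable series, over any commutative ring:
`[X^d] g(Γ) = Σ_{i ≤ |d|} g_i·[X^d] Γⁱ` (`Γ(0) = 0`). [folklore] -/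
theorem mvCoeff_subst_eq_sum_ring {S : Type*} [CommRing S] {σ : Type*} {Γ : MvPowerSeries σ S}
    (hΓ : MvPowerSeries.constantCoeff Γ = 0) (g : S⟦X⟧) (d : σ →₀ ℕ) :
    MvPowerSeries.coeff d (g.subst Γ) =
      ∑ i ∈ Finset.range (Finsupp.degree d + 1), coeff i g * MvPowerSeries.coeff d (Γ ^ i) := by
  have hs : HasSubst Γ := HasSubst.of_constantCoeff_zero hΓ
  rw [coeff_subst hs, finsum_eq_sum_of_support_subset _ (s := Finset.range (Finsupp.degree d + 1))]
  · simp only [smul_eq_mul]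
  · intro i hi
    rw [Function.mem_support] at hi
    rw [Finset.coe_range, Set.mem_Iio]
    by_contra h
    rw [not_lt] at h
    apply hi
    have hord : MvPowerSeries.coeff d (Γ ^ i) = 0 := by
      refine MvPowerSeries.coeff_of_lt_order ?_
      refine lt_of_lt_of_le ?_ (MvPowerSeries.le_order_pow_of_constantCoeff_eq_zero i hΓ)
      exact_mod_cast Nat.lt_of_lt_of_le (Nat.lt_succ_self _) h
    rw [hord, smul_zero]

/-- In `𝓞⟦σ⟧` every natural number prime to `3` is a unit. [folklore] -/
theorem isUnit_natCast_mvPowerSeries_ONine {σ : Type*} {r : ℕ} (hr : ¬ 3 ∣ r) :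
    IsUnit (r : MvPowerSeries σ ONine) := by
  have h : IsUnit (r : ℤ_[3]) := by
    rw [PadicInt.isUnit_iff, PadicInt.norm_natCast_eq_one_iff]
    exact (Nat.Prime.coprime_iff_not_dvd Nat.prime_three).mpr hr
  have h' : IsUnit (r : ONine) := by simpa using h.map (algebraMap ℤ_[3] ONine)
  simpa using h'.map (MvPowerSeries.C : ONine →+* MvPowerSeries σ ONine)

/-- **Katz's Key Lemma 5.1.3 over `𝓞`**: `n·[zⁿ]f ∈ ℤ₃` (`df` integral), `U, V ∈ 𝓞⟦σ⟧` without constant term and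
`U ≡ V (mod 3𝓞⟦σ⟧)` ⟹ `f(U) − f(V)` (computed over `ℚ₃(ζ₉)`) has `𝓞`-integral coefficients: `f(U) − f(V) = Σ f_m(Uᵐ − Vᵐ)`
and `m·3 ∣ Uᵐ − Vᵐ` absorbs the denominator of `f_m`. [cite: Katz1981CrystallineDieudonne, §5 Key Lemma 5.1.3] -/
theorem isIntegral_mvCoeff_subst_sub_subst {σ : Type*} {f : ℚ_[3]⟦X⟧} (hf : ∀ n : ℕ, ‖(n : ℚ_[3]) * coeff n f‖ ≤ 1)
    {U V : MvPowerSeries σ ONine} (hU0 : MvPowerSeries.constantCoeff U = 0) (hV0 : MvPowerSeries.constantCoeff V = 0)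
    (hUV : (3 : MvPowerSeries σ ONine) ∣ U - V) (d : σ →₀ ℕ) :
    IsIntegral ℤ_[3] (MvPowerSeries.coeff d
      ((f.map (algebraMap ℚ_[3] KNine)).subst (U.map (algebraMap ONine KNine)) -
        (f.map (algebraMap ℚ_[3] KNine)).subst (V.map (algebraMap ONine KNine)))) := by
  have hU0' : MvPowerSeries.constantCoeff (U.map (algebraMap ONine KNine)) = 0 := by
    rw [MvPowerSeries.constantCoeff_map, hU0, map_zero]
  have hV0' : MvPowerSeries.constantCoeff (V.map (algebraMap ONine KNine)) = 0 := by
    rw [MvPowerSeries.constantCoeff_map, hV0, map_zero]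
  rw [map_sub, mvCoeff_subst_eq_sum_ring hU0', mvCoeff_subst_eq_sum_ring hV0', ← Finset.sum_sub_distrib]
  refine IsIntegral.sum _ fun m _ ↦ ?_
  rw [coeff_map, ← mul_sub, ← map_pow, ← map_pow, ← map_sub, ← map_sub]
  obtain ⟨w, hw⟩ := natCast_mul_dvd_pow_sub_pow (R := MvPowerSeries σ ONine) (p := 3) (by norm_num)
    (fun _ hr => isUnit_natCast_mvPowerSeries_ONine hr) hUV m
  rw [hw, show ((m : MvPowerSeries σ ONine) * ((3 : ℕ) : MvPowerSeries σ ONine)) = MvPowerSeries.C ((m : ONine) * 3) by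
      rw [map_mul, map_natCast, map_ofNat, Nat.cast_ofNat], MvPowerSeries.coeff_map, MvPowerSeries.coeff_C_mul,
    map_mul, ← mul_assoc]
  -- `f_m · (m · 3)` comes from `ℤ₃`
  have hm : ‖(m : ℚ_[3]) * coeff m f‖ ≤ 1 := hf m
  set z : ℤ_[3] := ⟨(m : ℚ_[3]) * coeff m f, hm⟩ with hz
  have e : algebraMap ℚ_[3] KNine (coeff m f) * algebraMap ONine KNine ((m : ONine) * 3) =
      algebraMap ℤ_[3] KNine (z * 3) := by
    rw [IsScalarTower.algebraMap_apply ℤ_[3] ℚ_[3] KNine, map_mul, map_natCast, map_ofNat, hz]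
    change _ = algebraMap ℚ_[3] KNine (((m : ℚ_[3]) * coeff m f : ℚ_[3]) * 3)
    rw [map_mul, map_mul, map_natCast, map_ofNat]
    ring
  rw [e]
  exact isIntegral_algebraMap.mul (MvPowerSeries.coeff d w).2

/-! ## §4 Assembly: the transfer classes lie in Katz's module of the GOOD MODEL -/

section Assembly

/-- **Good model ≡ lift modulo `ϖ` ⟹ formal group laws ≡ modulo `ϖ`** (the coefficients of the chord–tangent law are
integer polynomials in the `aᵢ`: `map_formalGroupLaw` along `𝓞 → 𝓞/ϖ`). [cite: SilvermanAEC2009, IV.1] -/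
theorem formalGroupLaw_congr_mod {ϖ : ONine} {E E₀ : WeierstrassCurve ONine}
    (h : E.map (Ideal.Quotient.mk (Ideal.span {ϖ})) = E₀.map (Ideal.Quotient.mk (Ideal.span {ϖ}))) (d : Fin 2 →₀ ℕ) :
    ϖ ∣ MvPowerSeries.coeff d E.formalGroupLaw - MvPowerSeries.coeff d E₀.formalGroupLaw := by
  have hmap := congrArg WeierstrassCurve.formalGroupLaw h
  rw [← WeierstrassCurve.map_formalGroupLaw, ← WeierstrassCurve.map_formalGroupLaw] at hmap
  have hc := congrArg (MvPowerSeries.coeff d) hmap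
  rw [MvPowerSeries.coeff_map, MvPowerSeries.coeff_map, Ideal.Quotient.eq, Ideal.mem_span_singleton] at hc
  exact hc

/-- `(expand 9 f)(Γ) = f(Γ⁹)` over any commutative ring. [folklore] -/
theorem expand_nine_subst {S : Type*} [CommRing S] {τ : Type*} {Γ : MvPowerSeries τ S}
    (hΓ : MvPowerSeries.constantCoeff Γ = 0) (f : S⟦X⟧) :
    (expand 9 (by norm_num) f).subst Γ = f.subst (Γ ^ 9) := by
  have hs : HasSubst Γ := HasSubst.of_constantCoeff_zero hΓ
  rw [expand_apply, subst_comp_subst_apply (PowerSeries.HasSubst.X_pow (by norm_num)) hs, subst_pow hs, subst_X hs]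

/-- `f(Γ(X⁹,Y⁹)) = (f(Γ))(X⁹,Y⁹)` over any commutative ring. [folklore] -/
theorem subst_expand_nine {S : Type*} [CommRing S] {τ : Type*} {Γ : MvPowerSeries τ S}
    (hΓ : MvPowerSeries.constantCoeff Γ = 0) (f : S⟦X⟧) :
    f.subst (MvPowerSeries.expand 9 (by norm_num) Γ) = MvPowerSeries.expand 9 (by norm_num) (f.subst Γ) := by
  have hs : HasSubst Γ := HasSubst.of_constantCoeff_zero hΓ
  rw [PowerSeries.subst, PowerSeries.subst, MvPowerSeries.expand_subst _ _ hs.const]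

/-- **THE TRANSFER LANDS IN THE GOOD MODEL'S MODULE.** Let `E/𝓞` be a good model whose equation is congruent modulo
`ϖ` (`3 ∣ ϖ⁶`) to the `ℤ₃`-lift `V₀` (read in `𝓞`), `Ĝ`, `G₀` their formal group laws (read over `ℚ₃(ζ₉)`), and let
`f ∈ ℚ₃⟦z⟧` have `n·[zⁿ]f ∈ ℤ₃` and `G₀`-coboundary with coefficients of norm `≤ 3ᴮ` (second kind for `G₀`). Then the
`Ĝ`-COBOUNDARY OF `f(z⁹)`, `f(Ĝ⁹) − f(X⁹) − f(Y⁹)`, has coefficients `c_d` with `3ᴮ·c_d ∈ 𝓞`: the class `[f(z⁹)]`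
is an element of Katz's `D(Ê/𝓞)_ℚ` — applied to `f = log₀, log₀(z³)` this is the honesty of the transfer basis
`ℓ₀ = log₀(z⁹)`, `ℓ₁ = log₀(z²⁷)` (and, via `φ² = z⁹` there, of the Literature power maps).
[cite: Katz1981CrystallineDieudonne, §5 Thm 5.1.4] [cite: BerthelotOgus1983, Thm. 2.4 (proof)] -/
theorem transfer_coboundary_integral {ϖ : ONine} (hϖ : (3 : ONine) ∣ ϖ ^ 6) {E : WeierstrassCurve ONine}
    {V₀ : WeierstrassCurve ℤ_[3]}
    (hEV : E.map (Ideal.Quotient.mk (Ideal.span {ϖ})) =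
      (V₀.map (algebraMap ℤ_[3] ONine)).map (Ideal.Quotient.mk (Ideal.span {ϖ})))
    {f : ℚ_[3]⟦X⟧} (hf : ∀ n : ℕ, ‖(n : ℚ_[3]) * coeff n f‖ ≤ 1) {B : ℕ}
    (hcob : ∀ d, ‖MvPowerSeries.coeff d (f.subst (V₀.map PadicInt.Coe.ringHom).formalGroupLaw -
      f.subst (MvPowerSeries.X 0) - f.subst (MvPowerSeries.X 1))‖ ≤ (3 : ℝ) ^ B) (d : Fin 2 →₀ ℕ) :
    IsIntegral ℤ_[3] ((3 : KNine) ^ B * MvPowerSeries.coeff d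
      ((expand 9 (by norm_num) (f.map (algebraMap ℚ_[3] KNine))).subst (E.map (algebraMap ONine KNine)).formalGroupLaw -
        (expand 9 (by norm_num) (f.map (algebraMap ℚ_[3] KNine))).subst (MvPowerSeries.X 0) -
        (expand 9 (by norm_num) (f.map (algebraMap ℚ_[3] KNine))).subst (MvPowerSeries.X 1))) := by
  set fK := f.map (algebraMap ℚ_[3] KNine) with hfK
  set GO := E.formalGroupLaw with hGO
  set G0O := (V₀.map (algebraMap ℤ_[3] ONine)).formalGroupLaw with hG0O
  have hGK : (E.map (algebraMap ONine KNine)).formalGroupLaw = GO.map (algebraMap ONine KNine) := by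
    rw [hGO, WeierstrassCurve.map_formalGroupLaw]
  have hG0 : MvPowerSeries.constantCoeff GO = 0 := E.constantCoeff_formalGroupLaw
  have hG00 : MvPowerSeries.constantCoeff G0O = 0 := WeierstrassCurve.constantCoeff_formalGroupLaw _
  -- (1) the ninth-power congruence `GO⁹ ≡ G0O(X⁹,Y⁹) (mod 3)`
  have hcong : ∀ e, (3 : ONine) ∣ MvPowerSeries.coeff e GO ^ 9 - MvPowerSeries.coeff e G0O := by
    intro e
    have h1 := formalGroupLaw_congr_mod hEV e
    have h2 : MvPowerSeries.coeff e G0O = algebraMap ℤ_[3] ONine (MvPowerSeries.coeff e V₀.formalGroupLaw) := by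
      rw [hG0O, ← WeierstrassCurve.map_formalGroupLaw, MvPowerSeries.coeff_map]
    rw [h2] at h1 ⊢
    exact pow_nine_sub_dvd hϖ h1
  have hUV : (3 : MvPowerSeries (Fin 2) ONine) ∣ GO ^ 9 - MvPowerSeries.expand 9 (by norm_num) G0O := by
    choose c hc using three_dvd_coeff_pow_nine_sub_expand hcong
    refine ⟨fun e ↦ c e, MvPowerSeries.ext fun e ↦ ?_⟩
    rw [show (3 : MvPowerSeries (Fin 2) ONine) = MvPowerSeries.C (3 : ONine) from (map_ofNat _ 3).symm,
      MvPowerSeries.coeff_C_mul]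
    exact hc e
  -- (2) Key Lemma: `f(GO⁹) − f(G0O(X⁹,Y⁹))` integral
  have hkey := isIntegral_mvCoeff_subst_sub_subst hf
    (show MvPowerSeries.constantCoeff (GO ^ 9) = 0 by rw [map_pow, hG0, zero_pow (by norm_num)])
    (show MvPowerSeries.constantCoeff (MvPowerSeries.expand 9 (by norm_num) G0O) = 0 by
      rw [MvPowerSeries.constantCoeff_expand, hG00]) hUV d
  -- (3) the `G₀`-coboundary, mapped to `KNine` and expanded
  have hcomp : (algebraMap ONine KNine).comp (algebraMap ℤ_[3] ONine) =
      (algebraMap ℚ_[3] KNine).comp (PadicInt.Coe.ringHom (p := 3)) := by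
    ext x
    rw [RingHom.comp_apply, RingHom.comp_apply, ← IsScalarTower.algebraMap_apply ℤ_[3] ONine KNine x,
      IsScalarTower.algebraMap_apply ℤ_[3] ℚ_[3] KNine x]
    rfl
  have hG0K : G0O.map (algebraMap ONine KNine) = ((V₀.map PadicInt.Coe.ringHom).formalGroupLaw).map (algebraMap ℚ_[3] KNine) := by
    rw [hG0O, ← WeierstrassCurve.map_formalGroupLaw, ← WeierstrassCurve.map_formalGroupLaw, MvPowerSeries.map_map,
      MvPowerSeries.map_map, hcomp]
  have hX0 : ∀ i : Fin 2, MvPowerSeries.constantCoeff (MvPowerSeries.X i : MvPowerSeries (Fin 2) KNine) = 0 :=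
    fun i ↦ MvPowerSeries.constantCoeff_X i
  have hGK0 : MvPowerSeries.constantCoeff (GO.map (algebraMap ONine KNine)) = 0 := by
    rw [MvPowerSeries.constantCoeff_map, hG0, map_zero]
  have hG0K0 : MvPowerSeries.constantCoeff (G0O.map (algebraMap ONine KNine)) = 0 := by
    rw [MvPowerSeries.constantCoeff_map, hG00, map_zero]
  -- decomposition of the coboundary
  have hdec : (expand 9 (by norm_num) fK).subst (E.map (algebraMap ONine KNine)).formalGroupLaw -
        (expand 9 (by norm_num) fK).subst (MvPowerSeries.X 0) - (expand 9 (by norm_num) fK).subst (MvPowerSeries.X 1) =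
      (fK.subst ((GO ^ 9).map (algebraMap ONine KNine)) -
          fK.subst ((MvPowerSeries.expand 9 (by norm_num) G0O).map (algebraMap ONine KNine))) +
        MvPowerSeries.expand 9 (by norm_num)
          (fK.subst (G0O.map (algebraMap ONine KNine)) - fK.subst (MvPowerSeries.X 0) - fK.subst (MvPowerSeries.X 1)) := by
    rw [hGK, expand_nine_subst hGK0, expand_nine_subst (hX0 0), expand_nine_subst (hX0 1), map_sub, map_sub,
      ← subst_expand_nine hG0K0, ← subst_expand_nine (hX0 0), ← subst_expand_nine (hX0 1),
      MvPowerSeries.expand_X, MvPowerSeries.expand_X, map_pow, MvPowerSeries.map_expand]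
    ring
  rw [hdec, map_add, mul_add]
  refine IsIntegral.add ?_ ?_
  · -- integral outright, times `3^B`
    have h3 : IsIntegral ℤ_[3] ((3 : KNine) ^ B) := by
      rw [show (3 : KNine) = algebraMap ℤ_[3] KNine 3 by rw [map_ofNat]]; exact isIntegral_algebraMap.pow B
    exact h3.mul hkey
  · -- the expanded `G₀`-coboundary: coefficients are those of the `ℚ₃`-coboundary, bounded by `3^B`
    have hmapcob : fK.subst (G0O.map (algebraMap ONine KNine)) - fK.subst (MvPowerSeries.X 0) - fK.subst (MvPowerSeries.X 1) =
        (f.subst (V₀.map PadicInt.Coe.ringHom).formalGroupLaw - f.subst (MvPowerSeries.X 0) -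
          f.subst (MvPowerSeries.X 1)).map (algebraMap ℚ_[3] KNine) := by
      rw [hG0K, map_sub, map_sub, hfK, PowerSeries.map_subst (HasSubst.of_constantCoeff_zero
          (WeierstrassCurve.constantCoeff_formalGroupLaw _)),
        PowerSeries.map_subst (PowerSeries.HasSubst.X 0), PowerSeries.map_subst (PowerSeries.HasSubst.X 1),
        MvPowerSeries.map_X, MvPowerSeries.map_X]
    rw [hmapcob]
    set Φ := f.subst (V₀.map PadicInt.Coe.ringHom).formalGroupLaw - f.subst (MvPowerSeries.X 0) -
      f.subst (MvPowerSeries.X 1) with hΦ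
    by_cases hd : ∀ i, 9 ∣ d i
    · choose m hm using hd
      have e : d = 9 • (Finsupp.equivFunOnFinite.symm m : Fin 2 →₀ ℕ) := by
        ext i; simp [hm i]
      rw [e, MvPowerSeries.coeff_expand_smul, MvPowerSeries.coeff_map]
      -- `3^B * ι(c)` with `‖c‖ ≤ 3^B`
      set c := MvPowerSeries.coeff (Finsupp.equivFunOnFinite.symm m : Fin 2 →₀ ℕ) Φ with hc
      have hcn : ‖(3 : ℚ_[3]) ^ B * c‖ ≤ 1 := by
        rw [norm_mul, norm_pow, show ‖(3 : ℚ_[3])‖ = (3 : ℝ)⁻¹ by exact_mod_cast Padic.norm_p (p := 3), inv_pow]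
        calc ((3 : ℝ) ^ B)⁻¹ * ‖c‖ ≤ ((3 : ℝ) ^ B)⁻¹ * (3 : ℝ) ^ B := by gcongr; exact hcob _
          _ = 1 := inv_mul_cancel₀ (by positivity)
      set zc : ℤ_[3] := ⟨(3 : ℚ_[3]) ^ B * c, hcn⟩ with hzc
      have e2 : (3 : KNine) ^ B * algebraMap ℚ_[3] KNine c = algebraMap ℤ_[3] KNine zc := by
        rw [IsScalarTower.algebraMap_apply ℤ_[3] ℚ_[3] KNine, hzc]
        change _ = algebraMap ℚ_[3] KNine ((3 : ℚ_[3]) ^ B * c)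
        rw [map_mul, map_pow, map_ofNat]
      rw [e2]; exact isIntegral_algebraMap
    · obtain ⟨i, hi⟩ := not_forall.mp hd
      rw [MvPowerSeries.coeff_expand_of_not_dvd 9 (by norm_num) _ hi, mul_zero]
      exact isIntegral_zero

end Assembly

end Summit.BirchSwinnertonDyer.BirchSwinnertonDyer.Theorems.DescendedFrobeniusTransfer
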